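import Mathlib
import Literature.NumberTheory.LFunctions.Zhang2022.Section12Ded1217Sizes
import HarnessLib

/-!
# Zhang (2022) §12, discharge layer II: the `dr`-range splits of `S_j`, the size of `S_j(𝐚₁₂,𝐚₂₅)`, `E(𝐚₁₂,𝐚₂₅) = o(𝔓)`

Topic `Literature/NumberTheory/LFunctions/Zhang2022` (Landau–Siegel audit tree; verdict-neutral).
Y. Zhang, *Discrete mean estimates and the Landau–Siegel zero*, arXiv:2211.02515v1 (2022)
[Zhang2022LandauSiegel]. **Status of the source: an unrefereed manuscript under adjudication** (campaign D-0069, cell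
siegel-zhang). Everything in this file is PROVED (theorems only; no new definitions, no new facts);
nothing here is a claim about Theorems 1–2 of the source or about Landau–Siegel zeros.

Second of four files discharging `Z22:(12.17)` / `Skeleton.Ded1217 c′` from the typed §12 nodes.

| decl | content | locator |
|---|---|---|
| `SjOn_split`, `SjOn_congr`, `SjOn_eq_zero_of_left/right` | bookkeeping for `Typed.Sec12C.SjOn` (restricted `S_j`) | §12 p. 71 |
| `Sj_a12_split` | **"The sum is split into three sums according to `dr ≤ P″₁/T`, `P″₁/T < dr ≤ P″₁`, `P″₁ < dr < P₂`"** for `S_j(𝐚₁₂,𝐚₂₅)` — EXACT (the range `dr ≥ P₂` is empty: `𝐚₁₂ = 0` there) | p. 71, tex L3605 |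
| `Sj_a15_split` | **"split into two sums according to `dr ≤ P″₁` and `P″₁ < dr < P₂`"** for `S_j(𝐚₁₅,𝐚₂₂)` — EXACT | p. 73, tex L3688 |
| `norm_Sj_a12_le` | `S_j(𝐚₁₂,𝐚₂₅) = O(α𝔞) + O(α)` from (12.12) (`Eq1212`), the middle range (`Mid1225`), (12.14) (`Eq1214`) | (12.12)–(12.14) |
| `forAllLarge_log_ge`, `small_of_log_large` | "`D` large" bookkeeping | §2 p. 4 |
| `ecal_a12_small` | **`E(𝐚₁₂,𝐚₂₅) = 𝔓𝓛²Σ|S_j| = o(𝔓)`** ⇐ `Eq1212`, `Mid1225`, `Eq1214` (+ `𝔞 ≪ 𝓛⁴`, `α𝓛² = π𝓛⁻⁷`) — the TACIT input of "by Proposition 7.1" at (12.17), derived | §12 p. 73; §7 Prop. 7.1 |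

## References

* Y. Zhang, arXiv:2211.02515v1 (2022), §12 pp. 71–73, (12.12)–(12.14); §7 Prop. 7.1 p. 33.
  [cite: Zhang2022LandauSiegel, §12 (12.12)–(12.14)]
-/

noncomputable section

open Complex Real ComplexConjugate
open Literature.NumberTheory.LFunctions.Zhang2022
open Literature.NumberTheory.LFunctions.Zhang2022.Skeleton
open Literature.NumberTheory.LFunctions.Zhang2022.Typed.Sec12A
open Literature.NumberTheory.LFunctions.Zhang2022.Typed.Sec12C

namespace Literature.NumberTheory.LFunctions.Zhang2022.Sec12D

/-! ## Splitting `S_j` along the `dr`-ranges (pp. 71, 73) -/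

section Splits

variable (c' : ℝ) {D : ℕ} [NeZero D] (χ : DirichletCharacter ℂ D)

omit [NeZero D] in
/-- Refining a range: `S_j|_{R∧Q} + S_j|_{R∧¬Q} = S_j|_R`. [cite: Zhang2022LandauSiegel, §12 (12.12) p.71] -/
theorem SjOn_split (j : ℕ) (a₁ a₂ : ℕ → ℂ) (R Q : ℕ → Prop) :
    SjOn c' D j a₁ a₂ (fun k => R k ∧ Q k) + SjOn c' D j a₁ a₂ (fun k => R k ∧ ¬ Q k) =
      SjOn c' D j a₁ a₂ R := by
  classical
  unfold SjOn
  rw [← Finset.sum_add_distrib]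
  refine Finset.sum_congr rfl fun d _ => ?_
  rw [← Finset.sum_add_distrib]
  refine Finset.sum_congr rfl fun r _ => ?_
  by_cases h : R (d * r) <;> by_cases h' : Q (d * r) <;> simp [h, h']

omit [NeZero D] in
/-- Equivalent ranges give the same restricted sum. [cite: Zhang2022LandauSiegel, §12 (12.12) p.71] -/
theorem SjOn_congr (j : ℕ) (a₁ a₂ : ℕ → ℂ) {R R' : ℕ → Prop} (h : ∀ k, R k ↔ R' k) :
    SjOn c' D j a₁ a₂ R = SjOn c' D j a₁ a₂ R' := by
  have : R = R' := funext fun k => propext (h k)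
  rw [this]

omit [NeZero D] in
/-- A restricted sum vanishes if the first coefficient sequence vanishes on the range:
`a₁(drm) = 0` for all `m ≥ 1` whenever `R(dr)`. [cite: Zhang2022LandauSiegel, §12 (12.12) p.71] -/
theorem SjOn_eq_zero_of_left (j : ℕ) (a₁ a₂ : ℕ → ℂ) (R : ℕ → Prop)
    (h : ∀ d r : ℕ, 1 ≤ d → 1 ≤ r → R (d * r) → ∀ m : ℕ, 1 ≤ m → a₁ (d * r * m) = 0) :
    SjOn c' D j a₁ a₂ R = 0 := by
  classical
  unfold SjOn
  refine Finset.sum_eq_zero fun d hd => Finset.sum_eq_zero fun r hr => ?_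
  rw [Finset.mem_Ico] at hd hr
  split_ifs with hR
  · have : ∑ m ∈ Finset.Ico 1 (Nsupp D), a₁ (d * r * m) / (m : ℂ) ^ (1 - betaJ c' D j) = 0 := by
      refine Finset.sum_eq_zero fun m hm => ?_
      rw [Finset.mem_Ico] at hm
      rw [h d r hd.1 hr.1 hR m hm.1, zero_div]
    rw [this]; ring
  · rfl

omit [NeZero D] in
/-- A restricted sum vanishes if the second coefficient sequence vanishes on the range.
[cite: Zhang2022LandauSiegel, §12 (12.16) p.73] -/
theorem SjOn_eq_zero_of_right (j : ℕ) (a₁ a₂ : ℕ → ℂ) (R : ℕ → Prop)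
    (h : ∀ d r : ℕ, 1 ≤ d → 1 ≤ r → R (d * r) → ∀ n : ℕ, 1 ≤ n → a₂ (d * r * n) = 0) :
    SjOn c' D j a₁ a₂ R = 0 := by
  classical
  unfold SjOn
  refine Finset.sum_eq_zero fun d hd => Finset.sum_eq_zero fun r hr => ?_
  rw [Finset.mem_Ico] at hd hr
  split_ifs with hR
  · have : ∑ n ∈ Finset.Ico 1 (Nsupp D), a₂ (d * r * n) * xiZero c' D j n d r / (n : ℂ) = 0 := by
      refine Finset.sum_eq_zero fun n hn => ?_
      rw [Finset.mem_Ico] at hn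
      rw [h d r hd.1 hr.1 hR n hn.1, zero_mul, zero_div]
    rw [this]; ring
  · rfl

omit [NeZero D] in
/-- `T ≥ 1`. [cite: Zhang2022LandauSiegel, §6 p. 30] -/
theorem one_le_bigT (D : ℕ) : 1 ≤ bigT D :=
  Real.one_le_exp (Real.rpow_nonneg (by rw [ell]; exact Real.log_natCast_nonneg D) _)

omit [NeZero D] in
/-- A product `drm` with `m ≥ 1` and `dr ≥ X` is `≥ X` (as reals). [folklore] -/
private theorem le_mul_of_le {X : ℝ} {k m : ℕ} (hk : X ≤ k) (hm : 1 ≤ m) : X ≤ ((k * m : ℕ) : ℝ) := by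
  have : (k : ℝ) ≤ ((k * m : ℕ) : ℝ) := by exact_mod_cast Nat.le_mul_of_pos_right k hm
  linarith

/-- **"The sum is split into three sums according to `dr ≤ P″₁/T`, `P″₁/T < dr ≤ P″₁` and
`P″₁ < dr < P₂`"** (p. 71, tex L3605), for `S_j(𝐚₁₂,𝐚₂₅)` — EXACT: the omitted range `dr ≥ P₂`
contributes nothing because `𝐚₁₂(drm) = 0` there (`ϰ₂, ϰ₃` vanish from `P₂ ≥ P₃` on, `𝓛 ≥ 4`).
Kernel-checked bookkeeping. [cite: Zhang2022LandauSiegel, §12 (12.12) p.71] -/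
theorem Sj_a12_split (hD : 4 ≤ Real.log D) (j : ℕ) (a25 : ℕ → ℂ) :
    Sj c' D j (a12 χ) a25 =
      SjOn c' D j (a12 χ) a25 (rngLow D) + SjOn c' D j (a12 χ) a25 (rngMid D) +
        SjOn c' D j (a12 χ) a25 (rngTop D) := by
  have hD1 : 1 ≤ Real.log D := by linarith
  have hT := one_le_bigT D
  have hP1pp := P1pp_pos hD1
  -- `S_j = S_j|Top + S_j|¬Top`
  have e1 := SjOn_add_SjOn_not c' (D := D) j (a12 χ) a25 (rngTop D)
  -- `S_j|¬Top = S_j|(¬Top ∧ ≤P″₁) + S_j|(¬Top ∧ >P″₁)`, the latter `= 0`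
  have e2 := SjOn_split c' (D := D) j (a12 χ) a25 (fun k => ¬ rngTop D k) (rngBot D)
  have e3 : SjOn c' D j (a12 χ) a25 (fun k => ¬ rngTop D k ∧ ¬ rngBot D k) = 0 := by
    refine SjOn_eq_zero_of_left c' j (a12 χ) a25 _ fun d r _ _ hR m hm => ?_
    obtain ⟨h1, h2⟩ := hR
    simp only [rngTop, rngBot, not_and, not_lt, not_le] at h1 h2
    exact a12_eq_zero_of_P2_le χ hD (le_mul_of_le (h1 h2) hm)
  have e4 : SjOn c' D j (a12 χ) a25 (fun k => ¬ rngTop D k ∧ rngBot D k) =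
      SjOn c' D j (a12 χ) a25 (rngBot D) := by
    refine SjOn_congr c' j (a12 χ) a25 fun k => ?_
    simp only [rngTop, rngBot, not_and, not_lt]
    exact ⟨fun h => h.2, fun h => ⟨fun h' => absurd h (not_le.mpr h'), h⟩⟩
  -- `S_j|≤P″₁ = S_j|Mid + S_j|Low`
  have e5 := SjOn_split c' (D := D) j (a12 χ) a25 (rngBot D) (fun k => P1pp D / bigT D < k)
  have e6 : SjOn c' D j (a12 χ) a25 (fun k => rngBot D k ∧ P1pp D / bigT D < k) =
      SjOn c' D j (a12 χ) a25 (rngMid D) :=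
    SjOn_congr c' j (a12 χ) a25 fun k => by simp only [rngBot, rngMid]; exact and_comm
  have e7 : SjOn c' D j (a12 χ) a25 (fun k => rngBot D k ∧ ¬ (P1pp D / bigT D < k)) =
      SjOn c' D j (a12 χ) a25 (rngLow D) := by
    refine SjOn_congr c' j (a12 χ) a25 fun k => ?_
    simp only [rngBot, rngLow, not_lt]
    constructor
    · exact fun h => h.2
    · intro h
      exact ⟨h.trans (div_le_self hP1pp.le hT), h⟩
  rw [e3, add_zero, e4] at e2
  rw [e6, e7] at e5
  rw [← e1, ← e2, ← e5]
  ring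

/-- **"The sum is split into two sums according to `dr ≤ P″₁` and `P″₁ < dr < P₂`"** (p. 73, tex
L3688), for `S_j(𝐚₁₅,𝐚₂₂)` — EXACT: the range `dr ≥ P₂` contributes nothing because `𝐚₂₂(drn) = 0`
there (`𝓛 ≥ 4`). Kernel-checked bookkeeping. [cite: Zhang2022LandauSiegel, §12 (12.16) p.73] -/
theorem Sj_a15_split (hD : 4 ≤ Real.log D) (j : ℕ) (a15 : ℕ → ℂ) :
    Sj c' D j a15 (a22 χ) =
      SjOn c' D j a15 (a22 χ) (rngBot D) + SjOn c' D j a15 (a22 χ) (rngTop D) := by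
  have e1 := SjOn_add_SjOn_not c' (D := D) j a15 (a22 χ) (rngTop D)
  have e2 := SjOn_split c' (D := D) j a15 (a22 χ) (fun k => ¬ rngTop D k) (rngBot D)
  have e3 : SjOn c' D j a15 (a22 χ) (fun k => ¬ rngTop D k ∧ ¬ rngBot D k) = 0 := by
    refine SjOn_eq_zero_of_right c' j a15 (a22 χ) _ fun d r _ _ hR n hn => ?_
    obtain ⟨h1, h2⟩ := hR
    simp only [rngTop, rngBot, not_and, not_lt, not_le] at h1 h2
    exact a22_eq_zero_of_P2_le χ hD (le_mul_of_le (h1 h2) hn)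
  have e4 : SjOn c' D j a15 (a22 χ) (fun k => ¬ rngTop D k ∧ rngBot D k) =
      SjOn c' D j a15 (a22 χ) (rngBot D) := by
    refine SjOn_congr c' j a15 (a22 χ) fun k => ?_
    simp only [rngTop, rngBot, not_and, not_lt]
    exact ⟨fun h => h.2, fun h => ⟨fun h' => absurd h (not_le.mpr h'), h⟩⟩
  rw [e3, add_zero, e4] at e2
  rw [← e1, ← e2]
  ring

end Splits

/-! ## The size of `S_j(𝐚₁₂,𝐚₂₅)` from (12.12), the middle range and (12.14); `E(𝐚₁₂,𝐚₂₅) = o(𝔓)` -/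

section SizeA12

variable (c' : ℝ) {D : ℕ} [NeZero D] (χ : DirichletCharacter ℂ D)

omit [NeZero D] in
/-- `1/log P = α/π`. [cite: Zhang2022LandauSiegel, §2 (2.10)] -/
theorem inv_logP_eq (hD : 1 ≤ Real.log D) : (Real.log (bigP D))⁻¹ = alpha D / π := by
  have hπ : π ≠ 0 := Real.pi_pos.ne'
  have h := alpha_mul_logP (D := D) hD
  have hlog : Real.log (bigP D) ≠ 0 := by
    rw [Skeleton.log_bigP]; exact pow_ne_zero _ (by rw [ell]; linarith)
  field_simp
  linarith

/-- The norm of the main term of (12.12): `‖𝔞b*(log P)β_{j+1}β_{j+2}e*_{1j}‖ ≤ 𝔞‖b*‖·9π(1+5|c′|π)²·‖e*_{1j}‖·α`.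
[cite: Zhang2022LandauSiegel, §12 (12.12) p.71] -/
theorem norm_main1212int_le (hD : 1 ≤ Real.log D) (j : ℕ) :
    ‖main1212int c' χ j‖ ≤
      frakA χ * (‖bstar‖ * (9 * π * (1 + 5 * |c'| * π) ^ 2) * ‖estar1j j‖) * alpha D := by
  have hA := frakA_nonneg χ
  have hlog : 0 ≤ Real.log (bigP D) := by
    rw [Skeleton.log_bigP]; exact pow_nonneg (by rw [ell]; linarith) _
  have hβ := norm_betaJ_mul_betaJ_mul_logP_le c' hD (j + 1) (j + 2)
  rw [main1212int, norm_mul, norm_mul, norm_mul, norm_mul, Complex.norm_real, Complex.norm_real,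
    Real.norm_of_nonneg hA, Real.norm_of_nonneg hlog]
  calc frakA χ * ‖bstar‖ * Real.log (bigP D) * ‖betaJ c' D (j + 1) * betaJ c' D (j + 2)‖ * ‖estar1j j‖
      = frakA χ * ‖bstar‖ * ‖estar1j j‖ *
          (‖betaJ c' D (j + 1) * betaJ c' D (j + 2)‖ * Real.log (bigP D)) := by ring
    _ ≤ frakA χ * ‖bstar‖ * ‖estar1j j‖ * (9 * π * (1 + 5 * |c'| * π) ^ 2 * alpha D) := by
        gcongr
    _ = frakA χ * (‖bstar‖ * (9 * π * (1 + 5 * |c'| * π) ^ 2) * ‖estar1j j‖) * alpha D := by ring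

/-- The norm of the main term of (12.14): `‖𝔞/(0.504 log P)·c₀‖ = 𝔞α‖c₀‖/(0.504π)`.
[cite: Zhang2022LandauSiegel, §12 (12.14) p.72] -/
theorem norm_main1214_eq (hD : 1 ≤ Real.log D) :
    ‖main1214 χ‖ = frakA χ * alpha D / (0.504 * π) *
      ‖(-0.002 * conj iota3 / 0.498 - 0.008 * conj iota4 - 2 * π * I * conj iota4 / 250 ^ 2 : ℂ)‖ := by
  have hA := frakA_nonneg χ
  have hlogpos : 0 < Real.log (bigP D) := by
    rw [Skeleton.log_bigP]; exact pow_pos (by rw [ell]; linarith) _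
  have h504 : (0.504 : ℂ) = ((0.504 : ℝ) : ℂ) := by norm_num
  rw [main1214, norm_mul, norm_div, norm_mul, h504, Complex.norm_real, Complex.norm_real,
    Complex.norm_real, Real.norm_of_nonneg hA, Real.norm_of_nonneg hlogpos.le,
    Real.norm_of_nonneg (by norm_num : (0:ℝ) ≤ 0.504)]
  rw [div_eq_mul_inv (frakA χ), mul_inv, inv_logP_eq hD]
  field_simp

/-- The prefactor of (12.14): `𝔞/(0.504 log P) = 𝔞α/(0.504π)`. [cite: Zhang2022LandauSiegel, §12 (12.14) p.72] -/
theorem prefactor1214_eq (hD : 1 ≤ Real.log D) :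
    frakA χ / (0.504 * Real.log (bigP D)) = frakA χ * alpha D / (0.504 * π) := by
  rw [div_eq_mul_inv (frakA χ), mul_inv, inv_logP_eq hD]
  field_simp

/-- **`S_j(𝐚₁₂,𝐚₂₅) = O(α𝔞) + O(α)`** from the three range claims ((12.12) second form, the middle
range `o(α)`, (12.14)) at `ε = 1`: `‖S_j‖ ≤ α(𝔞K_j + 3)` with
`K_j = ‖b*‖9π(1+5|c′|π)²‖e*_{1j}‖ + (‖c₀‖ + 10⁻⁵/4)/(0.504π)`. [cite: Zhang2022LandauSiegel, §12 (12.12)–(12.14)] -/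
theorem norm_Sj_a12_le (hD : 4 ≤ Real.log D) (j : ℕ) (a25 : ℕ → ℂ)
    (hLow : ‖SjOn c' D j (a12 χ) a25 (rngLow D) - main1212int c' χ j‖ ≤ 1 * alpha D)
    (hMid : ‖SjOn c' D j (a12 χ) a25 (rngMid D)‖ ≤ 1 * alpha D)
    (hTop : ‖SjOn c' D j (a12 χ) a25 (rngTop D) - main1214 χ‖ ≤
      frakA χ / (0.504 * Real.log (bigP D)) * (1e-5 / 4) + 1 * alpha D) :
    ‖Sj c' D j (a12 χ) a25‖ ≤ alpha D * (frakA χ *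
      (‖bstar‖ * (9 * π * (1 + 5 * |c'| * π) ^ 2) * ‖estar1j j‖ +
        (‖(-0.002 * conj iota3 / 0.498 - 0.008 * conj iota4 - 2 * π * I * conj iota4 / 250 ^ 2 : ℂ)‖
          + 1e-5 / 4) / (0.504 * π)) + 3) := by
  have hD1 : 1 ≤ Real.log D := by linarith
  have h12 := norm_main1212int_le c' χ hD1 j
  have h14 := norm_main1214_eq χ hD1
  rw [prefactor1214_eq χ hD1] at hTop
  rw [Sj_a12_split c' χ hD j a25]
  set L := SjOn c' D j (a12 χ) a25 (rngLow D)
  set M := SjOn c' D j (a12 χ) a25 (rngMid D)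
  set T := SjOn c' D j (a12 χ) a25 (rngTop D)
  set m12 := main1212int c' χ j
  set m14 := main1214 χ
  have k1 : ‖L‖ ≤ ‖L - m12‖ + ‖m12‖ := by have := norm_sub_norm_le L m12; linarith
  have k2 : ‖T‖ ≤ ‖T - m14‖ + ‖m14‖ := by have := norm_sub_norm_le T m14; linarith
  have key : ‖L + M + T‖ ≤ ‖L - m12‖ + ‖m12‖ + ‖M‖ + (‖T - m14‖ + ‖m14‖) := by
    have := norm_add₃_le (a := L) (b := M) (c := T)
    linarith
  have hπ := Real.pi_pos
  set K₁ := ‖bstar‖ * (9 * π * (1 + 5 * |c'| * π) ^ 2) * ‖estar1j j‖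
  set n0 := ‖(-0.002 * conj iota3 / 0.498 - 0.008 * conj iota4 - 2 * π * I * conj iota4 / 250 ^ 2 : ℂ)‖
  have e : alpha D * (frakA χ * (K₁ + (n0 + 1e-5 / 4) / (0.504 * π)) + 3) =
      frakA χ * K₁ * alpha D + (frakA χ * alpha D / (0.504 * π) * n0 +
        frakA χ * alpha D / (0.504 * π) * (1e-5 / 4)) + 3 * alpha D := by
    field_simp
  rw [e]
  linarith [key, h12, hLow, hMid, hTop, k1, k2, h14.le, h14.ge]

end SizeA12

/-! ## `E(𝐚₁₂,𝐚₂₅) = o(𝔓)` -/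

section EcalA12

variable (c' : ℝ)

/-- "`D` large" includes `log D ≥ b` for any fixed `b`. [cite: Zhang2022LandauSiegel, §2 p. 4] -/
theorem forAllLarge_log_ge (b : ℝ) : ForAllLarge fun D _ _ => b ≤ Real.log D := by
  refine ⟨⌈Real.exp b⌉₊ + 1, fun D _ χ hD _ _ => ?_⟩
  have hD' : (⌈Real.exp b⌉₊ : ℝ) + 1 ≤ D := by exact_mod_cast hD
  have h1 : Real.exp b ≤ D := (Nat.le_ceil _).trans (by linarith)
  exact (Real.le_log_iff_exp_le (lt_of_lt_of_le (Real.exp_pos b) h1)).mpr h1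

/-- The arithmetic of "`E = 𝔓𝓛²Σ|S_j| = o(𝔓)`": if `𝔞 ≤ A₀𝓛⁴` and `𝓛 ≥ π(A₀K + 9)/ε` (`𝓛 ≥ 1`,
`K, A₀ ≥ 0`), then `(π/𝓛⁷)(𝔞K + 9) ≤ ε`. [cite: Zhang2022LandauSiegel, §7 Prop. 7.1 p.33] -/
theorem small_of_log_large {K A₀ A ℓ ε : ℝ} (hℓ : 1 ≤ ℓ) (hK : 0 ≤ K)
    (hA₀ : 0 ≤ A₀) (hAle : A ≤ A₀ * ℓ ^ 4) (hε : 0 < ε) (hb : π * (A₀ * K + 9) / ε ≤ ℓ) :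
    π / ℓ ^ 7 * (A * K + 9) ≤ ε := by
  have hπ := Real.pi_pos
  have hℓ0 : 0 < ℓ := by linarith
  have h1 : π / ℓ ^ 7 * (A * K + 9) ≤ π / ℓ ^ 7 * (A₀ * ℓ ^ 4 * K + 9) := by
    gcongr
  have h2 : π / ℓ ^ 7 * (A₀ * ℓ ^ 4 * K + 9) ≤ π * (A₀ * K + 9) / ℓ := by
    rw [div_mul_eq_mul_div, div_le_div_iff₀ (by positivity) (by positivity)]
    have h5 : ℓ ^ 5 ≤ ℓ ^ 7 := pow_le_pow_right₀ hℓ (by norm_num)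
    have h17 : ℓ ^ 1 ≤ ℓ ^ 7 := pow_le_pow_right₀ hℓ (by norm_num)
    rw [pow_one] at h17
    nlinarith [mul_nonneg (mul_nonneg hπ.le hA₀) hK, hπ]
  have h3 : π * (A₀ * K + 9) / ℓ ≤ ε := by
    rw [div_le_iff₀ hℓ0]
    have := (div_le_iff₀ hε).mp hb
    linarith
  linarith

/-- **The error term of Proposition 7.1 at `(𝐚₁₂,𝐚₂₅)` is negligible: `E(𝐚₁₂,𝐚₂₅) = o(𝔓)`** — the
TACIT input of "by Proposition 7.1" at (12.15)→(12.17), here DERIVED from the typed range claims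
(12.12), "middle range `o(α)`", (12.14) (each `S_j = O(α𝔞) + o(α)`), `𝔞 ≪ 𝓛⁴` and `α𝓛² = π𝓛⁻⁷`.
[cite: Zhang2022LandauSiegel, §12 (12.17) p.73; §7 Prop. 7.1] -/
theorem ecal_a12_small (h1212 : Eq1212 c') (hMid : Mid1225 c') (h1214 : Eq1214 c') :
    ∀ ε : ℝ, 0 < ε → ForAllLarge fun D _ χ => AssumptionA D χ →
      Ecal c' D (a12 χ) (a25 χ) ≤ ε * frakP D := by
  intro ε hε
  -- the constants
  set n0 := ‖(-0.002 * conj iota3 / 0.498 - 0.008 * conj iota4 - 2 * π * I * conj iota4 / 250 ^ 2 : ℂ)‖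
    with hn0
  set Kj : ℕ → ℝ := fun j => ‖bstar‖ * (9 * π * (1 + 5 * |c'| * π) ^ 2) * ‖estar1j j‖ +
    (n0 + 1e-5 / 4) / (0.504 * π) with hKj
  set K := Kj 1 + Kj 2 + Kj 3 with hK
  set A₀ : ℝ := 96 * Real.exp 9 / π ^ 2 with hA₀
  have hπ := Real.pi_pos
  have hKj0 : ∀ j, 0 ≤ Kj j := fun j => by positivity
  have hK0 : 0 ≤ K := by positivity
  have hA₀0 : 0 ≤ A₀ := by positivity
  obtain ⟨D₀, hall⟩ := (((h1212 1 one_pos).and (hMid 1 one_pos)).and (h1214 1 one_pos)).and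
    (forAllLarge_log_ge (max 4 (π * (A₀ * K + 9) / ε)))
  refine ⟨D₀, fun D _ χ hD hq hp hA => ?_⟩
  obtain ⟨⟨⟨e1212, eMid⟩, e1214⟩, hlog⟩ := hall D χ hD hq hp
  have hlog4 : 4 ≤ Real.log D := le_trans (le_max_left _ _) hlog
  have hlogb : π * (A₀ * K + 9) / ε ≤ Real.log D := le_trans (le_max_right _ _) hlog
  have hD1 : 1 ≤ Real.log D := by linarith
  have ha25 : ∀ n, a25 χ n = conj (χ (n : ZMod D) * vk13 D n) := fun n => rfl
  -- the three `S_j`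
  have hS : ∀ j ∈ ({1, 2, 3} : Finset ℕ), ‖Sj c' D j (a12 χ) (a25 χ)‖ ≤
      alpha D * (frakA χ * Kj j + 3) := by
    intro j hj
    have h1 := (e1212 hA (a25 χ) ha25 j hj).2
    have h2 := eMid hA (a25 χ) ha25 j hj
    have h3 := e1214 hA (a25 χ) ha25 j hj
    exact norm_Sj_a12_le c' χ hlog4 j (a25 χ) h1 h2 h3
  have hS1 := hS 1 (by simp)
  have hS2 := hS 2 (by simp)
  have hS3 := hS 3 (by simp)
  have hP := frakP_nonneg D
  have hAf := frakA_nonneg χ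
  have hα := (alpha_pos_of_log hD1).le
  have hℓ1 : 1 ≤ ell D := by rw [ell]; exact hD1
  -- `E ≤ 𝔓 𝓛² α (𝔞K + 9) = 𝔓 (π/𝓛⁷)(𝔞K + 9) ≤ ε𝔓`
  have hsum : ‖Sj c' D 1 (a12 χ) (a25 χ)‖ + ‖Sj c' D 2 (a12 χ) (a25 χ)‖ + ‖Sj c' D 3 (a12 χ) (a25 χ)‖
      ≤ alpha D * (frakA χ * K + 9) := by
    rw [hK]; nlinarith
  have hαℓ : alpha D * ell D ^ 2 = π / ell D ^ 7 := by
    have hℓ0 : ell D ≠ 0 := by linarith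
    rw [Section2.alpha_eq_pi_div_ell9]; field_simp
  have hsmall : π / ell D ^ 7 * (frakA χ * K + 9) ≤ ε :=
    small_of_log_large hℓ1 hK0 hA₀0 (frakA_le_ell_pow_four χ (by linarith) hp) hε
      (by rw [ell]; exact hlogb)
  rw [Ecal]
  calc frakP D * ell D ^ 2 *
        (‖Sj c' D 1 (a12 χ) (a25 χ)‖ + ‖Sj c' D 2 (a12 χ) (a25 χ)‖ + ‖Sj c' D 3 (a12 χ) (a25 χ)‖)
      ≤ frakP D * ell D ^ 2 * (alpha D * (frakA χ * K + 9)) := by gcongr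
    _ = frakP D * (π / ell D ^ 7 * (frakA χ * K + 9)) := by rw [← hαℓ]; ring
    _ ≤ frakP D * ε := by gcongr
    _ = ε * frakP D := by ring

end EcalA12

end Literature.NumberTheory.LFunctions.Zhang2022.Sec12D
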